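import Mathlib.Tactic
import HarnessLib

/-!
# Kozma–Nitzan's Question 8 — the observer-lens × cap bound for every relay count (gen 32)

Support file (`--supports stmt-CriticalPhenomena-4575`, closed crux; independent mathematics on Kozma–Nitzan's Question 8,
arXiv:2401.12397 §5.5 p. 36), prover `prim-ineq-gen-6` (gen 32).  No definitions, no named facts, no sorries; standard axioms.
Memo `run/shared/lean/prim/prim-ineq-gen-6/PROOF-OBSCAP-G32.md`.

In the merge induction for the uniform form (FINDING-G31 §5g) the depth-0 observer enters every per-depth demand through the
product `ṽ · θ_j` of its lens `ṽ = v₁/p₀` with the cap `θ_j` of class `j` (LEMMA V″).  The memo proves `ṽ · θ_j ≤ λ/(1+λ)` for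
every first crossing `k` and every class `j < k` ("THEOREM G-A"), which settles the vertex-1 A-defect part of the per-depth
inequality (INEQ-A at every depth, ratio ≤ 1/3) for all `k` at once.  The combinatorial inputs (root-cluster decompositions of
the channels, the union bound V″, a telescoping sum) live in the memo; this file certifies the algebraic skeleton:
`kq_compose` = the three memo inequalities (Q″), (step), (V″) imply LEMMA Q; `kq_theta` = LEMMA Q and the cap give
`B·θ ≤ λ/(1+λ)`; `k_ineqA_depth` = the corollary INEQ-A at a depth with prefix C-product `κ`, in product form.
[cite: KozmaNitzan2024, Question 8 (§5.5 p. 36)]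
-/

namespace Summit.CriticalPhenomena.PercolationContinuityZ3.Theorems

namespace PocketCert

/-- **LEMMA Q, algebraic assembly.**  With `κ ∈ [0,1]`, `(1+λ)κ ≥ 1`, channels `v, m ≥ 0`, union-bound lens `W ≥ 0`,
all-C-marked mass `Call` with `g = 1 − (1+λ)κ·Call ≥ 0`, and the three memo facts
(V″) `Φ ≤ v + W + Call`, (step) `v − ((1+λ)κ − 1)m ≤ S·A·g`, (Q″) `κ·S·A·(v+W) ≤ v + (1−κ)m`:
`((1−κ)m + v)((1+λ)κΦ − 1) ≤ λκ(m+v)(v+W)`.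
[cite: KozmaNitzan2024, Question 8 (§5.5 p. 36)] -/
theorem kq_compose (lam κ v m W Call Φ S A g : ℝ) (hk0 : 0 ≤ κ) (hk1 : κ ≤ 1)
    (hcross : 1 ≤ (1 + lam) * κ) (hv : 0 ≤ v) (hm : 0 ≤ m) (hW : 0 ≤ W)
    (hg : g = 1 - (1 + lam) * κ * Call) (hg0 : 0 ≤ g)
    (hV2 : Φ ≤ v + W + Call) (hstep : v - ((1 + lam) * κ - 1) * m ≤ S * A * g)
    (hQ2 : κ * (S * A) * (v + W) ≤ v + (1 - κ) * m) :
    ((1 - κ) * m + v) * ((1 + lam) * κ * Φ - 1) ≤ lam * κ * (m + v) * (v + W) := by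
  have hB : 0 ≤ (1 - κ) * m + v := by nlinarith
  have hk1l : 0 ≤ (1 + lam) * κ := by positivity
  -- replace Φ by its V″ bound
  have h1 : ((1 - κ) * m + v) * ((1 + lam) * κ * Φ - 1)
      ≤ ((1 - κ) * m + v) * ((1 + lam) * κ * (v + W) - g) := by
    apply mul_le_mul_of_nonneg_left _ hB
    rw [hg]; nlinarith [mul_le_mul_of_nonneg_left hV2 hk1l]
  -- the exact brace identity: [(1−κ)m+v](1+λ)κ − λκ(m+v) = κ(v − λ′m)
  have hid : ((1 - κ) * m + v) * ((1 + lam) * κ * (v + W) - g) - lam * κ * (m + v) * (v + W)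
      = κ * (v + W) * (v - ((1 + lam) * κ - 1) * m) - ((1 - κ) * m + v) * g := by ring
  -- case split on the sign of v − λ′m
  rcases le_or_gt (v - ((1 + lam) * κ - 1) * m) 0 with hneg | hpos
  · have : κ * (v + W) * (v - ((1 + lam) * κ - 1) * m) ≤ 0 := by
      have : 0 ≤ κ * (v + W) := by positivity
      nlinarith
    nlinarith [mul_nonneg hB hg0]
  · have h2 : κ * (v + W) * (v - ((1 + lam) * κ - 1) * m) ≤ κ * (v + W) * (S * A * g) := by
      apply mul_le_mul_of_nonneg_left hstep; positivity
    have h3 : κ * (v + W) * (S * A * g) = (κ * (S * A) * (v + W)) * g := by ring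
    have h4 : (κ * (S * A) * (v + W)) * g ≤ ((1 - κ) * m + v) * g := by
      apply mul_le_mul_of_nonneg_right _ hg0; linarith
    nlinarith

/-- **THEOREM G-A, last step.**  If LEMMA Q holds in the form `((1−κ)m+v)·N ≤ λκ(m+v)V` with `V > 0`,
`(1+λ)κ > 0`, and the cap satisfies `θ ≤ 1`, `0 ≤ θ` and `θ·(1+λ)κ·V ≤ N⁺` (i.e. `θ = min(1, N⁺/((1+λ)κV))` or smaller), then the
observer factor `B = ((1−κ)m+v)/(m+v)` obeys `B·θ ≤ λ/(1+λ)`; stated in product form.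
[cite: KozmaNitzan2024, Question 8 (§5.5 p. 36)] -/
theorem kq_theta (lam κ v m V N θ : ℝ) (hl : 0 < lam) (hk0 : 0 < κ) (hk1 : κ ≤ 1)
    (hv : 0 ≤ v) (hm : 0 ≤ m) (hV : 0 < V) (hθ0 : 0 ≤ θ) (hθ1 : θ ≤ 1)
    (hcap : θ * ((1 + lam) * κ * V) ≤ max N 0)
    (hQ : ((1 - κ) * m + v) * N ≤ lam * κ * (m + v) * V) :
    ((1 - κ) * m + v) * θ * (1 + lam) ≤ lam * (m + v) := by
  have hB : 0 ≤ (1 - κ) * m + v := by nlinarith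
  have hBle : (1 - κ) * m + v ≤ m + v := by nlinarith
  rcases le_or_gt N 0 with hN | hN
  · -- N ≤ 0: the cap forces θ(1+λ)κV ≤ 0, hence θ = 0
    have hmax : max N 0 = 0 := max_eq_right hN
    rw [hmax] at hcap
    have hpos : 0 < (1 + lam) * κ * V := by positivity
    have hθ : θ = 0 := le_antisymm (by nlinarith) hθ0
    subst hθ; nlinarith
  · have hmax : max N 0 = N := max_eq_left hN.le
    rw [hmax] at hcap
    -- ((1−κ)m+v)·θ(1+λ)κV ≤ ((1−κ)m+v)·N ≤ λκ(m+v)V, then cancel κV > 0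
    have h1 : ((1 - κ) * m + v) * (θ * ((1 + lam) * κ * V)) ≤ ((1 - κ) * m + v) * N :=
      mul_le_mul_of_nonneg_left hcap hB
    have h2 : (((1 - κ) * m + v) * θ * (1 + lam) - lam * (m + v)) * (κ * V) ≤ 0 := by nlinarith
    have hkV : 0 < κ * V := by positivity
    nlinarith [mul_pos hkV hl]

/-- **COROLLARY INEQ-A at depth `l` (all relay counts), product form.**  With `(1+λ′_l) = (1+λ)κ_l`, depth-0 weight
`w ≤ 1−λ`, the obs-cap bound in the averaged form `ṽΘ(1+λ) ≤ λ` (`Θ = Σ_j ω̃_jθ_j`, `Σ_j ω̃_j = 1`), `A a_l ≤ 1`, `p_l ≤ 1`: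
the vertex-1 A-defect demand `(1+λ)κ_l·w_l v_{l+1}·w ṽ(1−A)Θ` is at most one third of the R-share
`w_lκ_l(v_{l+1}/p_l)·¾(1−A)/(A a_l)`; multiplied through by `A a_l p_l > 0`.
[cite: KozmaNitzan2024, Question 8 (§5.5 p. 36)] -/
theorem k_ineqA_depth (lam κ wl vl w vt Θ A al pl : ℝ) (hl0 : 0 < lam) (hl1 : lam < 1)
    (hk : 0 ≤ κ) (hwl : 0 ≤ wl) (hvl : 0 ≤ vl) (hw0 : 0 ≤ w) (hw : w ≤ 1 - lam) (hvt : 0 ≤ vt) (hΘ : 0 ≤ Θ)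
    (hcap : vt * Θ * (1 + lam) ≤ lam) (hA0 : 0 < A) (hA1 : A ≤ 1) (ha0 : 0 < al) (ha1 : al ≤ 1)
    (hp0 : 0 < pl) (hp1 : pl ≤ 1) :
    3 * ((1 + lam) * κ * (wl * vl) * (w * vt) * (1 - A) * Θ) * (A * al * pl)
      ≤ wl * κ * vl * (3 / 4) * (1 - A) := by
  -- (1+λ)·w·ṽΘ ≤ (1−λ)λ ≤ 1/4 and A a_l p_l ≤ 1
  have h1 : (1 + lam) * (w * vt) * Θ ≤ (1 - lam) * lam := by
    have : w * (vt * Θ * (1 + lam)) ≤ (1 - lam) * lam := by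
      calc w * (vt * Θ * (1 + lam)) ≤ (1 - lam) * (vt * Θ * (1 + lam)) := by
            apply mul_le_mul_of_nonneg_right hw; positivity
        _ ≤ (1 - lam) * lam := by apply mul_le_mul_of_nonneg_left hcap; linarith
    nlinarith
  have h2 : (1 - lam) * lam ≤ 1 / 4 := by nlinarith [sq_nonneg (lam - 1 / 2)]
  have h3 : A * al * pl ≤ 1 := by
    calc A * al * pl ≤ 1 * 1 * 1 := by gcongr
      _ = 1 := by ring
  have h4 : 0 ≤ A * al * pl := by positivity
  have hX : 0 ≤ wl * κ * vl * (1 - A) := by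
    have : 0 ≤ 1 - A := by linarith
    positivity
  -- LHS = 3·[(1+λ) w ṽ Θ]·(A a_l p_l)·X with X = wl κ vl (1−A) ≥ 0
  have h5 : 3 * ((1 + lam) * κ * (wl * vl) * (w * vt) * (1 - A) * Θ) * (A * al * pl)
      = (3 * ((1 + lam) * (w * vt) * Θ) * (A * al * pl)) * (wl * κ * vl * (1 - A)) := by ring
  rw [h5]
  have h6 : 3 * ((1 + lam) * (w * vt) * Θ) * (A * al * pl) ≤ 3 / 4 := by
    have ha : 0 ≤ (1 + lam) * (w * vt) * Θ := by positivity
    calc 3 * ((1 + lam) * (w * vt) * Θ) * (A * al * pl) ≤ 3 * (1 / 4) * 1 := by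
          gcongr
          · linarith
      _ = 3 / 4 := by norm_num
  calc (3 * ((1 + lam) * (w * vt) * Θ) * (A * al * pl)) * (wl * κ * vl * (1 - A))
      ≤ (3 / 4) * (wl * κ * vl * (1 - A)) := mul_le_mul_of_nonneg_right h6 hX
    _ = wl * κ * vl * (3 / 4) * (1 - A) := by ring

end PocketCert

end Summit.CriticalPhenomena.PercolationContinuityZ3.Theorems
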